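import Mathlib
import HarnessLib

/-!
# S1a — grading the localisation `A[h⁻¹]` of a graded ring at a HOMOGENEOUS element `h`

[OURS · L1 W4.5c · lead-1 g6] — NOT a statement of the manuscript; counted 0; AI-level work, weaker than expert
review. Crux stmt-ResolutionOfSingularities-17941 (`WildQuotients.CyclicQuotientFourfolds`), line `s1a-logminvertex`,
stub `stub_localGame` (producer): the CHART RINGS of the kill game are localisations `R^w[h⁻¹]` of the graded
cobordant algebra at homogeneous `σ`-invariant elements (H3 `ChartClause`, H4a `CoarseChart.ChartRing`), and a node
chart needs them GRADED (`IsTameNode` asks for a `GradedRing`). Generic tool, Mathlib-level: Mathlib grades only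
the degree-`0` part (`HomogeneousLocalization`).

For a commutative ring `A` graded by an additive commutative group `κ` (`𝒜 : κ → AddSubgroup A`, `GradedRing 𝒜`)
and `h ∈ 𝒜 k`:
* `locPiece 𝒜 hh e` — the degree-`e` piece of `L = Localization.Away h`: the fractions `x / hᵐ` with
  `x ∈ 𝒜 (e + m • k)` (an additive subgroup);
* `locPiece.gradedMonoid` — `1 ∈ L₀`, `L_e · L_{e'} ⊆ L_{e+e'}`;
* `iSup_locPiece_eq_top` (every fraction is a sum of homogeneous fractions — decompose the numerator) and
  `iSupIndep_locPiece` (clearing denominators and reading one homogeneous component in `A`), whence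
  `isInternal_locPiece` and the **`GradedRing`** structure `locGradedRing 𝒜 hh` (noncomputable, via
  `DirectSum.IsInternal.chooseDecomposition`);
* the anti-costume pins: `algebraMap_mem_locPiece` (`x ∈ 𝒜 e ⇒ x/1 ∈ L_e`), `mk_mem_locPiece`
  (`x ∈ 𝒜 (e + m•k) ⇒ x/hᵐ ∈ L_e`), `invSelf_mem_locPiece` (`h⁻¹ ∈ L_{-k}`), and the normal form `mem_locPiece_iff`.
-/

set_option linter.dupNamespace false

noncomputable section

open DirectSum

namespace Summit.ResolutionOfSingularities.ResolutionOfSingularities.Theorems.WildQuotientResolution.S1.GradedLocalization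

universe u v

variable {κ : Type v} [AddCommGroup κ] [DecidableEq κ] {A : Type u} [CommRing A]
  (𝒜 : κ → AddSubgroup A) [GradedRing 𝒜] {h : A} {k : κ} (hh : h ∈ 𝒜 k)

/-- Clearing denominators in `A[h⁻¹]`: `x/hᵐ = (x hᵃ)/h^{m+a}`. -/
theorem algebraMap_mul_invSelf_pow_eq (x : A) (m a : ℕ) :
    algebraMap A (Localization.Away h) x * IsLocalization.Away.invSelf h ^ m =
      algebraMap A (Localization.Away h) (x * h ^ a) * IsLocalization.Away.invSelf h ^ (m + a) := by
  have h1 : algebraMap A (Localization.Away h) h * IsLocalization.Away.invSelf h = 1 :=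
    IsLocalization.Away.mul_invSelf h
  have hpow : algebraMap A (Localization.Away h) h ^ a * IsLocalization.Away.invSelf h ^ a = 1 := by
    rw [← mul_pow, h1, one_pow]
  rw [map_mul, map_pow, pow_add]
  linear_combination (-(algebraMap A (Localization.Away h) x * IsLocalization.Away.invSelf h ^ m)) * hpow

include hh in
/-- `x hᵃ` is homogeneous of degree `i + a • k` for `x ∈ 𝒜 i`. -/
theorem mul_pow_mem (a : ℕ) {i : κ} {x : A} (hx : x ∈ 𝒜 i) : x * h ^ a ∈ 𝒜 (i + a • k) :=
  SetLike.mul_mem_graded hx (SetLike.pow_mem_graded a hh)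

/-- **The degree-`e` piece of `A[h⁻¹]`**: fractions `x / hᵐ` with `x ∈ 𝒜 (e + m • k)`. [OURS · L1 W4.5c] -/
def locPiece (e : κ) : AddSubgroup (Localization.Away h) where
  carrier := {y | ∃ (m : ℕ) (x : A), x ∈ 𝒜 (e + m • k) ∧
    y = algebraMap A (Localization.Away h) x * IsLocalization.Away.invSelf h ^ m}
  zero_mem' := ⟨0, 0, zero_mem _, by rw [map_zero, zero_mul]⟩
  add_mem' := by
    rintro _ _ ⟨m₁, x₁, hx₁, rfl⟩ ⟨m₂, x₂, hx₂, rfl⟩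
    refine ⟨m₁ + m₂, x₁ * h ^ m₂ + x₂ * h ^ m₁, ?_, ?_⟩
    · refine add_mem ?_ ?_
      · have := mul_pow_mem 𝒜 hh m₂ hx₁
        rwa [add_assoc, ← add_nsmul] at this
      · have := mul_pow_mem 𝒜 hh m₁ hx₂
        rwa [add_assoc, ← add_nsmul, add_comm m₂ m₁] at this
    · rw [algebraMap_mul_invSelf_pow_eq x₁ m₁ m₂, algebraMap_mul_invSelf_pow_eq x₂ m₂ m₁, add_comm m₂ m₁,
        map_add, add_mul]
  neg_mem' := by
    rintro _ ⟨m, x, hx, rfl⟩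
    exact ⟨m, -x, neg_mem hx, by rw [map_neg, neg_mul]⟩

/-- Normal form of the elements of `L_e`. -/
theorem mem_locPiece_iff {e : κ} {y : Localization.Away h} :
    y ∈ locPiece 𝒜 hh e ↔ ∃ (m : ℕ) (x : A), x ∈ 𝒜 (e + m • k) ∧
      y = algebraMap A (Localization.Away h) x * IsLocalization.Away.invSelf h ^ m :=
  Iff.rfl

/-- `x / hᵐ ∈ L_e` for `x ∈ 𝒜 (e + m • k)`. -/
theorem mk_mem_locPiece {e : κ} (m : ℕ) {x : A} (hx : x ∈ 𝒜 (e + m • k)) :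
    algebraMap A (Localization.Away h) x * IsLocalization.Away.invSelf h ^ m ∈ locPiece 𝒜 hh e :=
  ⟨m, x, hx, rfl⟩

/-- `x / 1 ∈ L_e` for `x ∈ 𝒜 e` (the structure map is graded). -/
theorem algebraMap_mem_locPiece {e : κ} {x : A} (hx : x ∈ 𝒜 e) :
    algebraMap A (Localization.Away h) x ∈ locPiece 𝒜 hh e :=
  ⟨0, x, by rwa [zero_nsmul, add_zero], by rw [pow_zero, mul_one]⟩

/-- `h⁻¹ ∈ L_{-k}`. -/
theorem invSelf_mem_locPiece : IsLocalization.Away.invSelf h ∈ locPiece 𝒜 hh (-k) :=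
  ⟨1, 1, by rw [one_nsmul, neg_add_cancel]; exact SetLike.one_mem_graded 𝒜, by rw [map_one, one_mul, pow_one]⟩

/-- The pieces form a graded monoid. -/
theorem locPiece_gradedMonoid : SetLike.GradedMonoid (locPiece 𝒜 hh) where
  one_mem := ⟨0, 1, by rw [zero_nsmul, add_zero]; exact SetLike.one_mem_graded 𝒜,
    by rw [map_one, pow_zero, mul_one]⟩
  mul_mem := by
    rintro i j _ _ ⟨m₁, x₁, hx₁, rfl⟩ ⟨m₂, x₂, hx₂, rfl⟩
    refine ⟨m₁ + m₂, x₁ * x₂, ?_, by rw [map_mul, pow_add]; ring⟩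
    have := SetLike.mul_mem_graded hx₁ hx₂
    rwa [add_add_add_comm, ← add_nsmul] at this

/-- Every element of `A[h⁻¹]` is `x / hᵐ`. -/
theorem exists_eq_algebraMap_mul_invSelf_pow (y : Localization.Away h) :
    ∃ (x : A) (m : ℕ), y = algebraMap A (Localization.Away h) x * IsLocalization.Away.invSelf h ^ m := by
  obtain ⟨⟨x, ⟨_, ⟨m, rfl⟩⟩⟩, hy⟩ := IsLocalization.surj (Submonoid.powers h) y
  refine ⟨x, m, ?_⟩
  have h1 : algebraMap A (Localization.Away h) h * IsLocalization.Away.invSelf h = 1 :=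
    IsLocalization.Away.mul_invSelf h
  have e : y = y * (algebraMap A (Localization.Away h) h * IsLocalization.Away.invSelf h) ^ m := by
    rw [h1, one_pow, mul_one]
  rw [e, mul_pow, ← mul_assoc, ← map_pow]
  exact congrArg (· * IsLocalization.Away.invSelf h ^ m) hy

/-- **The pieces span**: decompose the numerator. -/
theorem iSup_locPiece_eq_top : ⨆ e, locPiece 𝒜 hh e = ⊤ := by
  classical
  rw [eq_top_iff]
  rintro y -
  obtain ⟨x, m, rfl⟩ := exists_eq_algebraMap_mul_invSelf_pow y
  rw [← DirectSum.sum_support_decompose 𝒜 x, map_sum, Finset.sum_mul]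
  refine AddSubgroup.sum_mem _ fun i _ => AddSubgroup.mem_iSup_of_mem (i - m • k) ?_
  exact mk_mem_locPiece 𝒜 hh m (by rw [sub_add_cancel]; exact (DirectSum.decompose 𝒜 x i).2)

/-- Elements of `⨆_{j ≠ e} L_j` are fractions `g / hᵐ` whose numerator has NO component of degree `e + m • k`. -/
theorem exists_of_mem_iSup_ne (e : κ) {y : Localization.Away h} (hy : y ∈ ⨆ (j) (_ : j ≠ e), locPiece 𝒜 hh j) :
    ∃ (m : ℕ) (g : A), (DirectSum.decompose 𝒜 g (e + m • k) : A) = 0 ∧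
      y = algebraMap A (Localization.Away h) g * IsLocalization.Away.invSelf h ^ m := by
  classical
  refine AddSubgroup.iSup_induction (fun j => ⨆ (_ : j ≠ e), locPiece 𝒜 hh j)
    (C := fun y => ∃ (m : ℕ) (g : A), (DirectSum.decompose 𝒜 g (e + m • k) : A) = 0 ∧
      y = algebraMap A (Localization.Away h) g * IsLocalization.Away.invSelf h ^ m) hy ?_ ?_ ?_
  · intro j y hy
    by_cases hje : j = e
    · subst hje
      rw [iSup_neg (fun h => h rfl), AddSubgroup.mem_bot] at hy
      exact ⟨0, 0, by simp, by rw [hy, map_zero, zero_mul]⟩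
    · rw [iSup_pos hje] at hy
      obtain ⟨m, x, hx, rfl⟩ := hy
      refine ⟨m, x, ?_, rfl⟩
      exact DirectSum.decompose_of_mem_ne 𝒜 hx (fun h' => hje (add_right_cancel h'))
  · exact ⟨0, 0, by simp, by rw [map_zero, zero_mul]⟩
  · rintro _ _ ⟨m₁, g₁, hg₁, rfl⟩ ⟨m₂, g₂, hg₂, rfl⟩
    refine ⟨m₁ + m₂, g₁ * h ^ m₂ + g₂ * h ^ m₁, ?_, ?_⟩
    · have e₁ : e + (m₁ + m₂) • k = (e + m₁ • k) + m₂ • k := by rw [add_nsmul, add_assoc]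
      have e₂ : e + (m₁ + m₂) • k = (e + m₂ • k) + m₁ • k := by rw [add_nsmul, add_comm (m₁ • k), add_assoc]
      rw [DirectSum.decompose_add, DirectSum.add_apply, AddSubgroup.coe_add]
      conv_lhs => congr; rw [e₁, DirectSum.coe_decompose_mul_add_of_right_mem 𝒜 (SetLike.pow_mem_graded m₂ hh), hg₁,
        zero_mul]
      rw [e₂, DirectSum.coe_decompose_mul_add_of_right_mem 𝒜 (SetLike.pow_mem_graded m₁ hh), hg₂, zero_mul,
        add_zero]
    · rw [algebraMap_mul_invSelf_pow_eq g₁ m₁ m₂, algebraMap_mul_invSelf_pow_eq g₂ m₂ m₁, add_comm m₂ m₁,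
        map_add, add_mul]

/-- **The pieces are independent**: clear denominators, then read one homogeneous component in `A`. -/
theorem iSupIndep_locPiece : iSupIndep (locPiece 𝒜 hh) := by
  classical
  intro e
  rw [disjoint_iff_inf_le]
  rintro y ⟨hy₁, hy₂⟩
  obtain ⟨m, x, hx, rfl⟩ := hy₁
  obtain ⟨m', g, hg, hyg⟩ := exists_of_mem_iSup_ne 𝒜 hh e hy₂
  -- clear denominators: `ι (x h^{m'}) = ι (g h^{m})`
  have h1 : algebraMap A (Localization.Away h) h * IsLocalization.Away.invSelf h = 1 :=
    IsLocalization.Away.mul_invSelf h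
  have hunit : IsUnit (IsLocalization.Away.invSelf h ^ (m + m')) := (IsUnit.of_mul_eq_one_right _ h1).pow _
  have e1 : algebraMap A (Localization.Away h) (x * h ^ m') =
      algebraMap A (Localization.Away h) (g * h ^ m) := by
    have := hyg
    rw [algebraMap_mul_invSelf_pow_eq x m m', algebraMap_mul_invSelf_pow_eq g m' m, add_comm m' m] at this
    exact hunit.mul_left_injective this
  -- hence `hᴺ x h^{m'} = hᴺ g h^{m}` in `A`
  obtain ⟨⟨_, N, rfl⟩, hN⟩ := (IsLocalization.eq_iff_exists (Submonoid.powers h) _).mp e1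
  simp only at hN
  -- read the component of degree `e + (m + m' + N) • k`: on the left the whole (homogeneous) element, on the
  -- right zero
  have hdeg : h ^ N * (x * h ^ m') ∈ 𝒜 (e + (m + m' + N) • k) := by
    have := SetLike.mul_mem_graded (SetLike.pow_mem_graded N hh) (mul_pow_mem 𝒜 hh m' hx)
    convert this using 2
    rw [add_nsmul, add_nsmul]
    abel
  have hzero : h ^ N * (x * h ^ m') = 0 := by
    have hcomp := congrArg (fun a : A => (DirectSum.decompose 𝒜 a (e + (m + m' + N) • k) : A)) hN
    simp only at hcomp
    rw [DirectSum.decompose_of_mem_same 𝒜 hdeg] at hcomp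
    rw [hcomp]
    have e₃ : e + (m + m' + N) • k = (e + m' • k) + (N + m) • k := by
      rw [add_nsmul, add_nsmul, add_nsmul]; abel
    rw [show h ^ N * (g * h ^ m) = g * h ^ (N + m) by ring, e₃,
      DirectSum.coe_decompose_mul_add_of_right_mem 𝒜 (SetLike.pow_mem_graded (N + m) hh), hg, zero_mul]
  -- so `y = ι x / hᵐ = ι (hᴺ x h^{m'}) / h^{m + m' + N} = 0`
  rw [AddSubgroup.mem_bot, algebraMap_mul_invSelf_pow_eq x m (m' + N),
    show x * h ^ (m' + N) = h ^ N * (x * h ^ m') by ring, hzero, map_zero, zero_mul]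

/-- The decomposition is internal. -/
theorem isInternal_locPiece : DirectSum.IsInternal (locPiece 𝒜 hh) := by
  classical
  refine ⟨?_, ?_⟩
  · exact (iSupIndep_locPiece 𝒜 hh).dfinsuppSumAddHom_injective
  · intro y
    have hy : y ∈ ⨆ e, locPiece 𝒜 hh e := by rw [iSup_locPiece_eq_top]; trivial
    refine AddSubgroup.iSup_induction (locPiece 𝒜 hh) (C := fun y => ∃ z, DirectSum.coeAddMonoidHom _ z = y)
      hy (fun e y hy => ⟨DirectSum.of _ e ⟨y, hy⟩, DirectSum.coeAddMonoidHom_of _ _ _⟩) ⟨0, map_zero _⟩ ?_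
    rintro _ _ ⟨z₁, rfl⟩ ⟨z₂, rfl⟩
    exact ⟨z₁ + z₂, map_add _ _ _⟩

/-- **`A[h⁻¹]` is a graded ring** with pieces `locPiece 𝒜 hh`. [OURS · L1 W4.5c] -/
@[implicit_reducible]
def locGradedRing : GradedRing (locPiece 𝒜 hh) :=
  { locPiece_gradedMonoid 𝒜 hh with
    toDecomposition := (isInternal_locPiece 𝒜 hh).chooseDecomposition }

end Summit.ResolutionOfSingularities.ResolutionOfSingularities.Theorems.WildQuotientResolution.S1.GradedLocalization

end
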